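import Summits.ResolutionOfSingularities.ResolutionOfSingularities.Theses.HomologicalConductor
import Summits.ResolutionOfSingularities.ResolutionOfSingularities.Theorems.HomologicalConductorNoZenoBirthDefs
import Summits.ResolutionOfSingularities.ResolutionOfSingularities.Theorems.HomologicalConductorNoZenoTowerNoetherian
import Summits.ResolutionOfSingularities.ResolutionOfSingularities.Theorems.HomologicalConductorPersistenceSTDCore
import Summits.ResolutionOfSingularities.ResolutionOfSingularities.Theorems.HomologicalConductorPersistenceCoreReduction
import Literature.AlgebraicGeometry.Resolution.RankOneReductionProofs
import HarnessLib

/-!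
# Crux `Persistence` (stmt-ResolutionOfSingularities-16484) — line `std` (planner res-L1-w44b-plan-1, chain W4.4b, 2026-08-26)

Route `ResolutionOfSingularities/HomologicalConductor`; the crux BY NAME is
`HomologicalConductor.Persistence`: `∀ m, ca (T_m) ⊆ ca (T_(m+1))` along the canonical tower
`T₀ = loc O A`, `T_(m+1) = loc O (nrm (chart O T_m))` (`NoZeno.Birth.tower`, verbatim the route's `let`s).

## The line (M-A′ «STD», tri-2 FS-5 + stub-2 p466272) — a SECOND line beside `birth`

`birth` (reshape 3/4) isolates the exponent-one core `x ∈ ca (nrm B[ca B/x])`, for which no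
mechanism is in print and the natural candidates are dead (Jacobian / different / MCM-extension /
plain syzygy DESCENT: CHAIN.md §2, CRUX-PLAN §2 N1–N8).  This line replaces the element-wise core by
an x-FREE STRUCTURAL statement about syzygy categories under ONE canonical step `B → C`,
`C = loc O (nrm (chart O B))`:

  STD_{t,e}(B → C): every `e`-th syzygy of a finitely generated `C`-module lies in the smallest class
  of `C`-modules containing the STRICT TRANSFORMS of `(t+1)`-th `B`-syzygies and the f.g. projectives,
  closed under isomorphism, binary products, retracts and first syzygies (Ω).

Evidence: 1663/1663 singular vertex charts of all cyclic quotient surfaces `1/n(1,q)`, `n ≤ 66`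
(tri-2, toric scan; plain descent fails at 128 of them, Ω of a strict transform repairs all 128).
Composition STD ⇒ transport of `caᵗ⁺¹(B)` into `caᵉ⁺¹(C)` is LANDED (stub-2, p466272
`PersistenceSTDCore.algebraMap_mem_cohomologyAnnihilator_of_omegaClosure`, Ω-closure by universal
property).

## Registered stubs (2)

* `stub_STD_local` (OPEN — the content): `∀ t, ∃ e, STD_{t,e}(B → loc O (nrm (chart O B)))` for every
  valuation ring `O ⊇ k` of `K` and every `k`-subalgebra `B ⊆ O` essentially of finite type with
  `Frac B = K`.  Why it might fail: non-toric normal surface points (D_n/E_n special points, minimally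
  elliptic), dimension ≥ 3, wild `z^p + F` — all untested; no printed mechanism.
* `stub_persistence_of_STD_tower` (GLUE, M-sized, assigned stub-3 as T3a; expected to close within the
  chain from p466272 + `PersistenceCoreReduction.ca_eq_image` + `tn_tower_invariant`): STD along the
  tower ⇒ `∀ m, ca (T_m) ⊆ ca (T_(m+1))`.

Composition `Persistence_of` (sorry-free): tower-ise `stub_STD_local` at `B := tower O A m`
(`STD_tower_of_local`, by `tower_succ = rfl` and `tn_tower_invariant`), apply the glue stub, and
re-abstract (`persistence_iff_tower`).  `[OURS · L1 w44b]` throughout; Iyengar–Takahashi 2016 enters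
nowhere in this line (their Thm 5.4 is used only by the RADICAL rung S-3, a different file).
-/

set_option linter.dupNamespace false

noncomputable section

open CategoryTheory
open scoped nonZeroDivisors

namespace Summit.ResolutionOfSingularities.ResolutionOfSingularities.Cruxes.Persistence.Lines.Std

open Summit.ResolutionOfSingularities.ResolutionOfSingularities.Theses.HomologicalConductor
open Literature.RingTheory.CohomologyAnnihilator (IsSyzygy cohomologyAnnihilator)
open Literature.AlgebraicGeometry.Resolution (isFractionRing_subalgebra_of_le)
open Summit.ResolutionOfSingularities.ResolutionOfSingularities.Theorems.NoZeno.Birth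
  (ca nrm loc chart tower tower_succ tn_tower_invariant)

universe u

/-- **STD_{t,e} along a ring hom `f : B → C`** (p466272's hypothesis `hSTD` verbatim with
`algebraMap B C` replaced by `f`). [OURS · L1 w44b] -/
def STDHom {B C : Type u} [CommRing B] [CommRing C] (f : B →+* C) (t e : ℕ) : Prop :=
  ∀ (M K : ModuleCat.{u} C), Module.Finite C M → IsSyzygy e M K →
    ∀ Q : ModuleCat.{u} C → Prop,
      (∀ Y : ModuleCat.{u} C, (∃ (X Y₀ : ModuleCat.{u} B) (φ : Y₀ →+ Y), Module.Finite B X ∧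
          IsSyzygy (t + 1) X Y₀ ∧ (∀ (b : B) (y : Y₀), φ (b • y) = f b • φ y) ∧
          Function.Injective φ ∧ Submodule.span C (Set.range φ) = ⊤) → Q Y) →
      (∀ P : ModuleCat.{u} C, Module.Finite C P → Projective P → Q P) →
      (∀ Y Y' : ModuleCat.{u} C, Q Y → Nonempty (Y ≅ Y') → Q Y') →
      (∀ Y₁ Y₂ : ModuleCat.{u} C, Q Y₁ → Q Y₂ → Q (ModuleCat.of C (Y₁ × Y₂))) →
      (∀ (Y Y' : ModuleCat.{u} C) (i : Y' ⟶ Y) (r : Y ⟶ Y'), i ≫ r = 𝟙 Y' → Q Y → Q Y') →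
      (∀ Y K : ModuleCat.{u} C, Q Y → IsSyzygy 1 Y K → Q K) → Q K

/-! ## Registered stubs -/

/-- `stub_STD_local` — THE OPEN CONTENT (x-free, one canonical step): for a valuation ring `O ⊇ k`
of `K` and a `k`-subalgebra `B ⊆ O` essentially of finite type with `Frac B = K`, for every `t`
some `e` with STD_{t,e}(B → loc O (nrm (chart O B))) along the inclusion. [OURS · L1 w44b] -/
theorem stub_STD_local : ∀ (k K : Type) [Field k] [Field K] [Algebra k K] (O : ValuationSubring K)
    (B : Subalgebra k K), (∀ c : k, algebraMap k K c ∈ O) → Algebra.EssFiniteType k ↥B →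
    IsFractionRing ↥B K → B.toSubring ≤ O.toSubring →
    ∀ (hle : B ≤ loc O (nrm (chart O B))) (t : ℕ), ∃ e : ℕ,
      STDHom (Subalgebra.inclusion hle).toRingHom t e := by
  sorry

/-- `stub_persistence_of_STD_tower` — GLUE (T3a, stub-3): STD along the tower transports `ca (T_m)`
into `ca (T_(m+1))`: `c ∈ ca (T_m)` ⇒ `⟨c,_⟩ ∈ cohomologyAnnihilator ↥T_m`
(`PersistenceCoreReduction.ca_eq_image`) ⇒ `∈ caᵗ⁺¹` for some `t` ⇒ p466272 along
`Subalgebra.inclusion` (birational: `T_m ≤ T_(m+1) ≤ K = Frac T_m`; torsion-free: subrings of a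
field; noetherian: essentially of finite type) ⇒ `c ∈ ca (T_(m+1))`. [OURS · L1 w44b] -/
theorem stub_persistence_of_STD_tower : ∀ (k K : Type) [Field k] [Field K] [Algebra k K]
    (O : ValuationSubring K) (A : Subalgebra k K), (∀ c : k, algebraMap k K c ∈ O) → A.FG →
    IsFractionRing ↥A K → A.toSubring ≤ O.toSubring →
    (∀ (m : ℕ) (hle : tower O A m ≤ tower O A (m + 1)) (t : ℕ), ∃ e : ℕ,
      STDHom (Subalgebra.inclusion hle).toRingHom t e) →
    ∀ m : ℕ, ca (tower O A m) ⊆ ca (tower O A (m + 1)) := by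
  sorry

/-! ## Sorry-free composition -/

/-- Re-abstraction: the crux over the named tower. [OURS · L1 w44b] -/
theorem persistence_iff_tower : Persistence ↔ ∀ p : ℕ, p.Prime →
    ∀ (k K : Type) [Field k] [CharP k p] [Field K] [Algebra k K] (O : ValuationSubring K)
      (A : Subalgebra k K), (∀ c : k, algebraMap k K c ∈ O) → A.FG → IsFractionRing ↥A K →
      A.toSubring ≤ O.toSubring → ∀ m : ℕ, ca (tower O A m) ⊆ ca (tower O A (m + 1)) :=
  ⟨fun h p hp k K _ _ _ _ O A hk hfg hfr hAO => h p hp k K O A hk hfg hfr hAO,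
    fun h p hp k K _ _ _ _ O A hk hfg hfr hAO => h p hp k K O A hk hfg hfr hAO⟩

/-- Tower-isation of the local stub: at `B := tower O A m` the hypotheses of `stub_STD_local` hold
(`tn_tower_invariant`, `isFractionRing_subalgebra_of_le`) and `tower O A (m+1)` IS
`loc O (nrm (chart O (tower O A m)))` (`tower_succ`, `rfl`). [OURS · L1 w44b] -/
theorem STD_tower_of_local
    (hloc : ∀ (k K : Type) [Field k] [Field K] [Algebra k K] (O : ValuationSubring K)
      (B : Subalgebra k K), (∀ c : k, algebraMap k K c ∈ O) → Algebra.EssFiniteType k ↥B →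
      IsFractionRing ↥B K → B.toSubring ≤ O.toSubring →
      ∀ (hle : B ≤ loc O (nrm (chart O B))) (t : ℕ), ∃ e : ℕ,
        STDHom (Subalgebra.inclusion hle).toRingHom t e)
    (k K : Type) [Field k] [Field K] [Algebra k K] (O : ValuationSubring K) (A : Subalgebra k K)
    (hk : ∀ c : k, algebraMap k K c ∈ O) (hA : A.FG) (hfr : IsFractionRing ↥A K)
    (hAO : A.toSubring ≤ O.toSubring) (m : ℕ) (hle : tower O A m ≤ tower O A (m + 1)) (t : ℕ) :
    ∃ e : ℕ, STDHom (Subalgebra.inclusion hle).toRingHom t e := by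
  obtain ⟨hAT, hTO, hET⟩ := tn_tower_invariant O A hk hA hfr hAO m
  haveI := hfr
  have hTfrac : IsFractionRing ↥(tower O A m) K := isFractionRing_subalgebra_of_le A _ hAT
  exact hloc k K O (tower O A m) hk hET hTfrac hTO hle t

/-- **`Persistence_of`** — the line concludes the crux BY NAME from its two registered stubs.
[OURS · L1 w44b] -/
theorem Persistence_of
    (h₁ : ∀ (k K : Type) [Field k] [Field K] [Algebra k K] (O : ValuationSubring K)
      (B : Subalgebra k K), (∀ c : k, algebraMap k K c ∈ O) → Algebra.EssFiniteType k ↥B →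
      IsFractionRing ↥B K → B.toSubring ≤ O.toSubring →
      ∀ (hle : B ≤ loc O (nrm (chart O B))) (t : ℕ), ∃ e : ℕ,
        STDHom (Subalgebra.inclusion hle).toRingHom t e)
    (h₂ : ∀ (k K : Type) [Field k] [Field K] [Algebra k K]
      (O : ValuationSubring K) (A : Subalgebra k K), (∀ c : k, algebraMap k K c ∈ O) → A.FG →
      IsFractionRing ↥A K → A.toSubring ≤ O.toSubring →
      (∀ (m : ℕ) (hle : tower O A m ≤ tower O A (m + 1)) (t : ℕ), ∃ e : ℕ,
        STDHom (Subalgebra.inclusion hle).toRingHom t e) →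
      ∀ m : ℕ, ca (tower O A m) ⊆ ca (tower O A (m + 1))) :
    Persistence :=
  persistence_iff_tower.mpr fun _ _ k K _ _ _ _ O A hk hA hfr hAO =>
    h₂ k K O A hk hA hfr hAO (fun m hle t => STD_tower_of_local h₁ k K O A hk hA hfr hAO m hle t)

/-- The composition instantiated at the stubs (shape check; carries their `sorry`s). -/
theorem Persistence_of_stubs : Persistence :=
  Persistence_of stub_STD_local stub_persistence_of_STD_tower

end Summit.ResolutionOfSingularities.ResolutionOfSingularities.Cruxes.Persistence.Lines.Std

end
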